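import Mathlib
import Literature.NumberTheory.LFunctions.Zhang2022.AppendixAStepAu007ReadTail
import HarnessLib

/-!
# Zhang (2022), Appendix A part 1 (proof of Lemma 8.3): Z22:§A.u007, prefactor-free reading —
# `𝒰_j(d,h;s) = ∏_{q<D} 𝔱_j(d,h,s;q) + O(D^{−c})` on `σ > 9/10`, from the Euler-product core

Topic `Literature/NumberTheory/LFunctions/Zhang2022` (Landau–Siegel audit tree; verdict-neutral).
Y. Zhang, *Discrete mean estimates and the Landau–Siegel zero*, arXiv:2211.02515v1 (2022)
[Zhang2022LandauSiegel], Appendix A p. 101, tex L5000, **an unrefereed manuscript under adjudication;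
nothing here asserts or denies its Theorems 1–2.** The typed leaf `Typed.AppendixA1.StepA_u007_read c′`
(hypothesis `hRead` of `Skeleton.theorem1_of_leaves_v19`) says: for `D` large, under (A), for
`1 ≤ j ≤ 3`, `d, h ≥ 1`, `dh < PT⁻²`, EVERY function `U` holomorphic on `σ > 9/10` that agrees with
`𝒰_j(d,h;·) = calU` on `σ > 1` satisfies `‖U(s) − ∏_{q<D}𝔱_j(d,h,s;q)‖ ≤ C·D^{−c}` for all `σ > 9/10`.

This file PROVES it from the EULER-PRODUCT CORE of the printed proof — the two facts
(i) `s ↦ ∏'_q 𝔱_j(d,h,s;q)` is holomorphic on `σ > 9/10` and (ii) `∏'_q 𝔱_j(d,h,s;q) = 𝒰_j(d,h;s)` for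
`σ > 1` (Z22:§A.u004, prefactor-free reading) — taken here as an explicit hypothesis in the leaf's own
frame (`stepA_u007_read_of_core`; the core is the content of the sibling leaf `hAn`,
`StepA_u007_analytic`, seat zl-w09-p1 of the ZHANG-L lane): by the identity theorem on the half-plane
`σ > 9/10` (`eqOn_tprod_frakt_of_continuation`) any such `U` IS the Euler product there, and the tail
estimate `AppendixAStepAu007ReadTail.norm_tprod_frakt_sub_prod_le` (absolute form, `c = 3/10`) finishes.

WHAT THIS IS NOT: a proof of the core (i)–(ii), or of anything about Theorems 1–2 / Landau–Siegel zeros.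

## References

* Y. Zhang, arXiv:2211.02515v1 (2022), Appendix A p. 101 (tex L4999–L5002); §8 Lemma 8.3 p. 46.
  [cite: Zhang2022LandauSiegel, App. A]
-/

noncomputable section

open Complex Real Filter Topology Finset

namespace Literature.NumberTheory.LFunctions.Zhang2022.Lemma83

open Literature.NumberTheory.LFunctions.Zhang2022
open Literature.NumberTheory.LFunctions.Zhang2022.Skeleton
open Literature.NumberTheory.LFunctions.Zhang2022.Typed.AppendixA1

/-- `PT⁻² ≤ P` (`T = e^{𝓛^{1.1}} ≥ 1`). [cite: Zhang2022LandauSiegel, §2 (2.6), §6 p. 12] -/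
theorem bigP_div_bigT_sq_le (D : ℕ) : bigP D / bigT D ^ 2 ≤ bigP D := by
  have hP0 : 0 < bigP D := Real.exp_pos _
  have hℓ : 0 ≤ ell D := by rw [ell]; exact Real.log_natCast_nonneg D
  have hT1 : 1 ≤ bigT D := Real.one_le_exp (Real.rpow_nonneg hℓ _)
  exact div_le_self hP0.le (one_le_pow₀ hT1)

/-- **Identification of continuations with the Euler product** (App. A p. 101, tex L4999: "so
`𝒰_j(d,h;s)` is analytic in this region"): if `s ↦ ∏'_q 𝔱_j(d,h,s;q)` is holomorphic on `σ > 9/10`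
and equals `𝒰_j(d,h;s)` for `σ > 1`, then every `U` holomorphic on `σ > 9/10` with `U = 𝒰_j(d,h;·)`
on `σ > 1` coincides with `∏'_q 𝔱_j` on the whole half-plane (identity theorem on the connected open
half-plane; both agree near `s = 2`). [cite: Zhang2022LandauSiegel, App. A p. 101, tex L4999] -/
theorem eqOn_tprod_frakt_of_continuation (c' : ℝ) {D : ℕ} [NeZero D] (χ : DirichletCharacter ℂ D)
    {j d h : ℕ}
    (hdiff : DifferentiableOn ℂ (fun s => ∏' q : Nat.Primes, frakt c' χ j d h s q)
      {s : ℂ | 9 / 10 < s.re})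
    (hid : ∀ s : ℂ, 1 < s.re → (∏' q : Nat.Primes, frakt c' χ j d h s q) = calU c' χ j d h s)
    {U : ℂ → ℂ} (hU : DifferentiableOn ℂ U {s : ℂ | 9 / 10 < s.re})
    (hUeq : ∀ s : ℂ, 1 < s.re → U s = calU c' χ j d h s) :
    Set.EqOn U (fun s => ∏' q : Nat.Primes, frakt c' χ j d h s q) {s : ℂ | 9 / 10 < s.re} := by
  have hO : IsOpen {z : ℂ | 9 / 10 < z.re} := isOpen_lt continuous_const Complex.continuous_re
  have hV : IsOpen {z : ℂ | 1 < z.re} := isOpen_lt continuous_const Complex.continuous_re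
  refine (hU.analyticOnNhd hO).eqOn_of_preconnected_of_eventuallyEq (hdiff.analyticOnNhd hO)
    (convex_halfSpace_re_gt (9 / 10)).isPreconnected (z₀ := 2)
    (by show (9 : ℝ) / 10 < (2 : ℂ).re; norm_num) ?_
  refine Filter.eventuallyEq_of_mem (hV.mem_nhds (by show (1 : ℝ) < (2 : ℂ).re; norm_num))
    fun z hz => ?_
  have hz' : 1 < z.re := hz
  show U z = ∏' q : Nat.Primes, frakt c' χ j d h z q
  rw [hUeq z hz', hid z hz']

/-- **Z22:§A.u007 (prefactor-free reading) from the Euler-product core**: if, for `D` large and under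
(A), for `1 ≤ j ≤ 3`, `d, h ≥ 1`, `dh < PT⁻²`, (i) `s ↦ ∏'_q 𝔱_j(d,h,s;q)` is holomorphic on `σ > 9/10`
and (ii) `∏'_q 𝔱_j(d,h,s;q) = 𝒰_j(d,h;s)` for `σ > 1`, then `Typed.AppendixA1.StepA_u007_read c′` holds,
with `c = 3/10` and an absolute `C`: any continuation `U` equals `∏'_q 𝔱_j` on `σ > 9/10`
(`eqOn_tprod_frakt_of_continuation`) and `‖∏'_q 𝔱_j − ∏_{q<D} 𝔱_j‖ ≤ C·D^{−3/10}` there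
(`norm_tprod_frakt_sub_prod_le`, using `dh < PT⁻² ≤ P`). [cite: Zhang2022LandauSiegel, App. A p. 101, tex L5000] -/
theorem stepA_u007_read_of_core (c' : ℝ)
    (hcore : ForAllLarge fun D _ χ => AssumptionA D χ → ∀ j ∈ ({1, 2, 3} : Finset ℕ), ∀ d h : ℕ,
      1 ≤ d → 1 ≤ h → ((d * h : ℕ) : ℝ) < bigP D / bigT D ^ 2 →
        DifferentiableOn ℂ (fun s => ∏' q : Nat.Primes, frakt c' χ j d h s q)
            {s : ℂ | 9 / 10 < s.re} ∧
          ∀ s : ℂ, 1 < s.re → (∏' q : Nat.Primes, frakt c' χ j d h s q) = calU c' χ j d h s) :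
    StepA_u007_read c' := by
  obtain ⟨C, D₁, hT⟩ := norm_tprod_frakt_sub_prod_le c'
  have hlarge : ForAllLarge fun D _ _ => D₁ ≤ D := ForAllLarge.of_le D₁ fun D _ _ hD _ _ => hD
  refine ⟨3 / 10, by norm_num, C,
    (hcore.and hlarge).mono fun D _ χ _ _ hS hA j hj d h hd hh hdh U hU hUeq s hs => ?_⟩
  obtain ⟨hc, hD⟩ := hS
  obtain ⟨hdiff, hid⟩ := hc hA j hj d h hd hh hdh
  have hEq := eqOn_tprod_frakt_of_continuation c' χ hdiff hid hU hUeq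
  have hUs : U s = ∏' q : Nat.Primes, frakt c' χ j d h s q := hEq hs
  have hdhP : ((d * h : ℕ) : ℝ) < bigP D := hdh.trans_le (bigP_div_bigT_sq_le D)
  rw [hUs]
  exact hT D χ hD j hj d h hd hh hdhP s hs

end Literature.NumberTheory.LFunctions.Zhang2022.Lemma83

end
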